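import Mathlib.NumberTheory.Padics.RingHoms
import Literature.NumberTheory.EllipticCurves.KramerCurvesPadic
import Summits.QuantumAdvantage.QuantumAdvantage.Theorems.MobiusLadderLiouvilleNotPPolyStubSplitAtT
import HarnessLib

/-!
# Crux `MobiusLadder.LiouvilleNotPPoly` (stmt-QuantumAdvantage-1389) — lemmas for stub `stub_multAtShift`

Line `SketchIdeator2` (idea `selmer-parity-transfer`), stub C2 (LEAD), `p`-adic part: Tate's
algorithm for the `X₁(3)` family `E_t : y² + x·y + t·y = x³` (`a₁ = 1`, `a₃ = t`,
`a₂ = a₄ = a₆ = 0`; `b₂ = 1`, `b₄ = t`, `b₆ = t²`, `c₄ = 1 − 24t`, `Δ = t³(1 − 27t)`) over `ℤ_p`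
at a prime `p ∣ 27t − 1`: the given equation is integral with unit `c₄` (`9 c₄ + 8 (27t − 1) = 1`)
and `p ∣ Δ`, hence MINIMAL with MULTIPLICATIVE reduction; its node-tangent polynomial
`c₄ T² + c₄ T − (54 t² − 3 t)` is `27⁻¹ · (3 T² + 3 T + 1)` over `𝔽_p` (`27 t ≡ 1`), and with
`Y = 3 T + 1` one has `3 (3 T² + 3 T + 1) = Y² + Y + 1`, so the reduction is SPLIT iff `𝔽_p`
contains a primitive cube root of unity iff `p ≡ 1 (mod 3)` (`p ≠ 3` automatically; `p = 2`:
`Y² + Y + 1` is irreducible over `𝔽₂`, consistent). Template: `KramerCurvesPadic.lean` (same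
shape at `q ∣ m`); `hesse_c₄`, `hesse_Δ` come from the landed stub C1 file
`MobiusLadderLiouvilleNotPPolyStubSplitAtT.lean`. The place-indexed registered statement is in the sibling file
`MobiusLadderLiouvilleNotPPolyStubMultAtShift.lean`.
-/

set_option linter.dupNamespace false -- D-0017: single-problem summit ⇒ `QuantumAdvantage.QuantumAdvantage` by design

noncomputable section

open scoped Classical

namespace Summit.QuantumAdvantage.QuantumAdvantage.Theorems.LiouvilleNotPPoly

open IsDedekindDomain IsLocalRing Polynomial WeierstrassCurve Rat.HeightOneSpectrum

/-! ### The family `E_t = ⟨1, 0, t, 0, 0⟩` over any commutative ring -/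

section Family

variable {R : Type*} [CommRing R] (t : R)

/-- `b₂(E_t) = 1`. -/
theorem hesse_b₂ : (WeierstrassCurve.mk 1 0 t 0 0).b₂ = 1 := by
  simp [WeierstrassCurve.b₂]

/-- `b₄(E_t) = t`. -/
theorem hesse_b₄ : (WeierstrassCurve.mk 1 0 t 0 0).b₄ = t := by
  simp [WeierstrassCurve.b₄]

/-- `b₆(E_t) = t²`. -/
theorem hesse_b₆ : (WeierstrassCurve.mk 1 0 t 0 0).b₆ = t ^ 2 := by
  simp [WeierstrassCurve.b₆]

-- `hesse_c₄ : c₄(E_t) = 1 − 24 t` and `hesse_Δ : Δ(E_t) = t³ (1 − 27 t)` are the landed lemmas of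
-- the sibling stub file `MobiusLadderLiouvilleNotPPolyStubSplitAtT.lean` (same namespace).

/-- The family is compatible with base change. -/
theorem hesse_map {S : Type*} [CommRing S] (f : R →+* S) :
    (WeierstrassCurve.mk 1 0 t 0 0).map f = WeierstrassCurve.mk 1 0 (f t) 0 0 := by
  simp [WeierstrassCurve.map]

end Family

/-! ### Cube roots of unity in `𝔽_p` -/

section CubeRoots

variable {p : ℕ} [hp : Fact p.Prime]

/-- For a prime `p ≠ 3`: `Y² + Y + 1` has a root in `𝔽_p` iff `p ≡ 1 (mod 3)` (a root is a unit of
order `3`, and `#𝔽_pˣ = p − 1`). -/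
theorem zmod_exists_cubeRoot_iff (hp3 : p ≠ 3) :
    (∃ y : ZMod p, y ^ 2 + y + 1 = 0) ↔ p % 3 = 1 := by
  haveI h3 : Fact (Nat.Prime 3) := ⟨Nat.prime_three⟩
  have h2 := hp.out.two_le
  -- `3 ≠ 0` in `𝔽_p`
  have h30 : (3 : ZMod p) ≠ 0 := by
    intro h
    have : (p : ℕ) ∣ 3 := by
      have := (ZMod.natCast_eq_zero_iff 3 p).mp (by exact_mod_cast h)
      exact this
    exact hp3 ((Nat.prime_dvd_prime_iff_eq hp.out Nat.prime_three).mp this)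
  constructor
  · rintro ⟨y, hy⟩
    have hy3 : y ^ 3 = 1 := by linear_combination (y - 1) * hy
    have hy1 : y ≠ 1 := by
      rintro rfl
      apply h30
      linear_combination hy
    set u : (ZMod p)ˣ := Units.mkOfMulEqOne y (y ^ 2) (by rw [← pow_succ']; exact hy3) with hu
    have hu3 : orderOf u = 3 := by
      refine orderOf_eq_prime ?_ ?_
      · ext; rw [Units.val_pow_eq_pow_val]; simpa [hu] using hy3
      · intro h; apply hy1; simpa [hu] using congrArg Units.val h
    have hdvd : 3 ∣ Fintype.card (ZMod p)ˣ := hu3 ▸ orderOf_dvd_card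
    rw [ZMod.card_units p] at hdvd
    omega
  · intro hp1
    have hdvd : 3 ∣ Fintype.card (ZMod p)ˣ := by rw [ZMod.card_units p]; omega
    obtain ⟨u, hu⟩ := exists_prime_orderOf_dvd_card 3 hdvd
    refine ⟨u, ?_⟩
    have hu3 : ((u : ZMod p)) ^ 3 = 1 := by
      rw [← Units.val_pow_eq_pow_val, ← hu, pow_orderOf_eq_one, Units.val_one]
    have hu1 : (u : ZMod p) ≠ 1 := by
      intro h
      have : u = 1 := Units.ext h
      rw [this, orderOf_one] at hu
      norm_num at hu
    have h0 : ((u : ZMod p) - 1) * ((u : ZMod p) ^ 2 + u + 1) = 0 := by linear_combination hu3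
    rcases mul_eq_zero.mp h0 with h | h
    · exact absurd (sub_eq_zero.mp h) hu1
    · exact h

end CubeRoots


/-! ### `E_t` over `ℚ_p` at a prime `p ∣ 27 t − 1` -/

section Padic

variable (p : ℕ) [hp : Fact p.Prime]

/-- `E_t ⊗ ℚ_p` is the base change of the `ℤ_p`-integral equation `E_t / ℤ_p`. -/
theorem baseChange_hesse_padicInt (t : ℤ) :
    (WeierstrassCurve.mk 1 0 (t : ℤ_[p]) 0 0).baseChange ℚ_[p] =
      WeierstrassCurve.mk 1 0 (t : ℚ_[p]) 0 0 := by
  rw [baseChange, hesse_map, map_intCast]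

/-- `(E_t / ℚ) ⊗ ℚ_p = E_t / ℚ_p`. -/
theorem baseChange_padic_hesse_rat (t : ℤ) :
    (WeierstrassCurve.mk 1 0 (t : ℚ) 0 0).baseChange ℚ_[p] =
      WeierstrassCurve.mk 1 0 (t : ℚ_[p]) 0 0 := by
  rw [baseChange, hesse_map, map_intCast]

/-- `E_t / ℚ_p` is `ℤ_p`-integral. -/
theorem isIntegral_hesse_padic (t : ℤ) :
    (WeierstrassCurve.mk 1 0 (t : ℚ_[p]) 0 0).IsIntegral ℤ_[p] :=
  ⟨⟨WeierstrassCurve.mk 1 0 (t : ℤ_[p]) 0 0, (baseChange_hesse_padicInt p t).symm⟩⟩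

/-- Mathlib's integral model of `E_t / ℚ_p` is the equation `E_t / ℤ_p` itself. -/
theorem integralModel_hesse_padic (t : ℤ) :
    haveI := isIntegral_hesse_padic p t
    (WeierstrassCurve.mk 1 0 (t : ℚ_[p]) 0 0).integralModel ℤ_[p] =
      WeierstrassCurve.mk 1 0 (t : ℤ_[p]) 0 0 := by
  haveI := isIntegral_hesse_padic p t
  apply WeierstrassCurve.map_injective (f := algebraMap ℤ_[p] ℚ_[p]) (IsFractionRing.injective _ _)
  change ((WeierstrassCurve.mk 1 0 (t : ℚ_[p]) 0 0).integralModel ℤ_[p]).baseChange ℚ_[p] =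
    (WeierstrassCurve.mk 1 0 (t : ℤ_[p]) 0 0).baseChange ℚ_[p]
  rw [baseChange_integralModel_eq, baseChange_hesse_padicInt]

variable {p}

/-- If `p ∣ 27 t − 1` then `27 t − 1 ∈ 𝔪_{ℤ_p}`. -/
theorem shift_mem_maximalIdeal {t : ℤ} (hpt : (p : ℤ) ∣ 27 * t - 1) :
    (27 * (t : ℤ_[p]) - 1) ∈ maximalIdeal ℤ_[p] := by
  have h := Literature.NumberTheory.EllipticCurves.intCast_mem_maximalIdeal_padicInt (q := p) hpt
  push_cast at h
  exact h

/-- `c₄(E_t) = 1 − 24 t` is a `p`-adic unit for `p ∣ 27 t − 1`: `9 c₄ + 8 (27 t − 1) = 1`. -/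
theorem c₄_hesse_not_mem_maximalIdeal {t : ℤ} (hpt : (p : ℤ) ∣ 27 * t - 1) :
    (WeierstrassCurve.mk 1 0 (t : ℤ_[p]) 0 0).c₄ ∉ maximalIdeal ℤ_[p] := by
  intro h
  have hm := shift_mem_maximalIdeal hpt
  have h1 : (1 : ℤ_[p]) ∈ maximalIdeal ℤ_[p] := by
    have e : (1 : ℤ_[p]) = 9 * (WeierstrassCurve.mk 1 0 (t : ℤ_[p]) 0 0).c₄ +
        8 * (27 * (t : ℤ_[p]) - 1) := by
      rw [hesse_c₄]; ring
    rw [e]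
    exact Ideal.add_mem _ (Ideal.mul_mem_left _ _ h) (Ideal.mul_mem_left _ _ hm)
  exact (maximalIdeal.isMaximal ℤ_[p]).ne_top ((Ideal.eq_top_iff_one _).mpr h1)

/-- `Δ(E_t) = −t³ (27 t − 1) ∈ 𝔪_{ℤ_p}` for `p ∣ 27 t − 1`. -/
theorem Δ_hesse_mem_maximalIdeal {t : ℤ} (hpt : (p : ℤ) ∣ 27 * t - 1) :
    (WeierstrassCurve.mk 1 0 (t : ℤ_[p]) 0 0).Δ ∈ maximalIdeal ℤ_[p] := by
  rw [hesse_Δ, show (t : ℤ_[p]) ^ 3 * (1 - 27 * (t : ℤ_[p])) =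
    (-(t : ℤ_[p]) ^ 3) * (27 * (t : ℤ_[p]) - 1) by ring]
  exact Ideal.mul_mem_left _ _ (shift_mem_maximalIdeal hpt)

/-- `v_p(c₄(E_t / ℚ_p)) = 1` (unit `c₄`) for `p ∣ 27 t − 1`. -/
theorem valuation_c₄_hesse_padic {t : ℤ} (hpt : (p : ℤ) ∣ 27 * t - 1) :
    (IsDiscreteValuationRing.maximalIdeal ℤ_[p]).valuation ℚ_[p]
      (WeierstrassCurve.mk 1 0 (t : ℚ_[p]) 0 0).c₄ = 1 := by
  rw [← baseChange_hesse_padicInt, baseChange, map_c₄,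
    HeightOneSpectrum.valuation_eq_one_iff_notMem]
  exact c₄_hesse_not_mem_maximalIdeal hpt

/-- `v_p(Δ(E_t / ℚ_p)) < 1` for `p ∣ 27 t − 1`. -/
theorem valuation_Δ_hesse_padic {t : ℤ} (hpt : (p : ℤ) ∣ 27 * t - 1) :
    (IsDiscreteValuationRing.maximalIdeal ℤ_[p]).valuation ℚ_[p]
      (WeierstrassCurve.mk 1 0 (t : ℚ_[p]) 0 0).Δ < 1 := by
  rw [← baseChange_hesse_padicInt, baseChange, map_Δ,
    HeightOneSpectrum.valuation_lt_one_iff_mem]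
  exact Δ_hesse_mem_maximalIdeal hpt

/-- **`E_t / ℚ_p` is a minimal equation at `p ∣ 27 t − 1`** (unit `c₄`). -/
theorem isMinimal_hesse_padic {t : ℤ} (hpt : (p : ℤ) ∣ 27 * t - 1) :
    (WeierstrassCurve.mk 1 0 (t : ℚ_[p]) 0 0).IsMinimal ℤ_[p] :=
  haveI := isIntegral_hesse_padic p t
  isMinimal_of_valuation_c₄_eq_one _ (valuation_c₄_hesse_padic hpt)

/-- **`E_t / ℚ_p` has multiplicative reduction at `p ∣ 27 t − 1`** (`v(Δ) > 0`, `v(c₄) = 0`). -/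
theorem hasMultiplicativeReduction_hesse_padic {t : ℤ} (hpt : (p : ℤ) ∣ 27 * t - 1) :
    (WeierstrassCurve.mk 1 0 (t : ℚ_[p]) 0 0).HasMultiplicativeReduction ℤ_[p] :=
  haveI := isMinimal_hesse_padic hpt
  { badReduction := valuation_Δ_hesse_padic hpt
    multiplicativeReduction := valuation_c₄_hesse_padic hpt }

/-- The node-tangent polynomial of `E_t / ℤ_p` reduced modulo `p`: with `c = c̄₄` and
`d = 54 t̄² − 3 t̄` it is `c T² + c T − d` (`a₁ = 1`, `a₂ = 0`, `b₂ = 1`, `b₄ = t`, `b₆ = t²`). -/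
theorem nodalTangents_hesse_padic (t : ℤ) :
    letI I := WeierstrassCurve.mk 1 0 (t : ℤ_[p]) 0 0
    Polynomial.map (algebraMap ℤ_[p] (ResidueField ℤ_[p]))
      (C I.c₄ * X ^ 2 + C (I.a₁ * I.c₄) * X - C (54 * I.b₆ - 3 * I.b₂ * I.b₄ + I.a₂ * I.c₄)) =
      C (algebraMap ℤ_[p] (ResidueField ℤ_[p]) (1 - 24 * (t : ℤ_[p]))) * X ^ 2 +
        C (algebraMap ℤ_[p] (ResidueField ℤ_[p]) (1 - 24 * (t : ℤ_[p]))) * X -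
        C (algebraMap ℤ_[p] (ResidueField ℤ_[p]) (54 * (t : ℤ_[p]) ^ 2 - 3 * (t : ℤ_[p]))) := by
  simp only [hesse_c₄, hesse_b₂, hesse_b₄, hesse_b₆, one_mul, mul_one, zero_mul, add_zero,
    Polynomial.map_sub, Polynomial.map_add, Polynomial.map_mul, Polynomial.map_pow,
    Polynomial.map_C, Polynomial.map_X]

end Padic

/-! ### The node-tangent polynomial modulo `p`: split iff `p ≡ 1 (mod 3)` -/

section Split

variable {p : ℕ} [hp : Fact p.Prime]

/-- A prime dividing `27 t − 1` is not `3`. -/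
theorem ne_three_of_dvd_shift {t : ℤ} (hpt : (p : ℤ) ∣ 27 * t - 1) : p ≠ 3 := by
  rintro rfl
  have : (3 : ℤ) ∣ 27 * t - 1 := by exact_mod_cast hpt
  omega

/-- `3 ≠ 0` in the residue field of `ℤ_p` for `p ≠ 3` (through `ℤ_p / p ≅ ℤ/p`). -/
theorem three_ne_zero_residueField (hp3 : p ≠ 3) : (3 : ResidueField ℤ_[p]) ≠ 0 := by
  intro h
  have h' : (3 : ZMod p) = 0 := by
    have := congrArg (PadicInt.residueField (p := p)) h
    rwa [map_ofNat, map_zero] at this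
  have hdvd : p ∣ 3 := (ZMod.natCast_eq_zero_iff 3 p).mp (by exact_mod_cast h')
  exact hp3 ((Nat.prime_dvd_prime_iff_eq hp.out Nat.prime_three).mp hdvd)

/-- `Y² + Y + 1` has a root in the residue field of `ℤ_p` iff it has one in `ℤ/p`. -/
theorem residueField_exists_cubeRoot_iff :
    (∃ y : ResidueField ℤ_[p], y ^ 2 + y + 1 = 0) ↔ ∃ y : ZMod p, y ^ 2 + y + 1 = 0 := by
  constructor
  · rintro ⟨y, hy⟩
    refine ⟨PadicInt.residueField (p := p) y, ?_⟩
    have := congrArg (PadicInt.residueField (p := p)) hy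
    simpa using this
  · rintro ⟨y, hy⟩
    refine ⟨(PadicInt.residueField (p := p)).symm y, ?_⟩
    have := congrArg (PadicInt.residueField (p := p)).symm hy
    simpa using this

/-- **The splitting criterion.** For `p ∣ 27 t − 1` the reduced node-tangent polynomial
`c̄ T² + c̄ T − d̄` of `E_t / ℤ_p` (`c = 1 − 24 t`, `d = 54 t² − 3 t`) splits over the residue
field iff `p ≡ 1 (mod 3)`: `27 c̄ = 3`, `27 d̄ = −1`, so `27 · (c̄ T² + c̄ T − d̄) = 3 T² + 3 T + 1`,
and `3 (3 T² + 3 T + 1) = Y² + Y + 1` with `Y = 3 T + 1`. -/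
theorem splits_nodalTangents_hesse_iff {t : ℤ} (hpt : (p : ℤ) ∣ 27 * t - 1) :
    Splits (C (algebraMap ℤ_[p] (ResidueField ℤ_[p]) (1 - 24 * (t : ℤ_[p]))) * X ^ 2 +
        C (algebraMap ℤ_[p] (ResidueField ℤ_[p]) (1 - 24 * (t : ℤ_[p]))) * X -
        C (algebraMap ℤ_[p] (ResidueField ℤ_[p]) (54 * (t : ℤ_[p]) ^ 2 - 3 * (t : ℤ_[p])))) ↔
      p % 3 = 1 := by
  set f := algebraMap ℤ_[p] (ResidueField ℤ_[p]) with hf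
  set s : ResidueField ℤ_[p] := f (t : ℤ_[p]) with hs
  have h27 : 27 * s = 1 := by
    have h0 : f (27 * (t : ℤ_[p]) - 1) = 0 := by
      rw [hf, IsLocalRing.ResidueField.algebraMap_eq, residue_eq_zero_iff]
      exact shift_mem_maximalIdeal hpt
    rwa [map_sub, map_mul, map_one, map_ofNat, sub_eq_zero] at h0
  have h3 : (3 : ResidueField ℤ_[p]) ≠ 0 := three_ne_zero_residueField (ne_three_of_dvd_shift hpt)
  have h81 : (81 : ResidueField ℤ_[p]) ≠ 0 := by
    have := pow_ne_zero 4 h3; norm_num at this; exact this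
  have hc : f (1 - 24 * (t : ℤ_[p])) = 1 - 24 * s := by
    simp only [map_sub, map_mul, map_one, map_ofNat, hs]
  have hd : f (54 * (t : ℤ_[p]) ^ 2 - 3 * (t : ℤ_[p])) = 54 * s ^ 2 - 3 * s := by
    simp only [map_sub, map_mul, map_pow, map_ofNat, hs]
  rw [hc, hd]
  have hc0 : (1 - 24 * s) ≠ 0 := by
    intro h0
    apply h3
    linear_combination 27 * h0 + 24 * h27
  have hdeg : degree (C (1 - 24 * s) * X ^ 2 + C (1 - 24 * s) * X - C (54 * s ^ 2 - 3 * s)) = 2 := by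
    rw [sub_eq_add_neg, ← C_neg]
    exact degree_quadratic hc0
  have heval : ∀ x : ResidueField ℤ_[p],
      eval x (C (1 - 24 * s) * X ^ 2 + C (1 - 24 * s) * X - C (54 * s ^ 2 - 3 * s)) =
        (1 - 24 * s) * x ^ 2 + (1 - 24 * s) * x - (54 * s ^ 2 - 3 * s) := by
    intro x; simp [eval_sub, eval_add, eval_mul, eval_pow, eval_C, eval_X]
  rw [← zmod_exists_cubeRoot_iff (ne_three_of_dvd_shift hpt), ← residueField_exists_cubeRoot_iff]
  constructor
  · intro hspl
    obtain ⟨x, hx⟩ := hspl.exists_eval_eq_zero (by rw [hdeg]; exact two_ne_zero)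
    rw [heval] at hx
    refine ⟨3 * x + 1, ?_⟩
    linear_combination 81 * hx + (3 * (24 * x ^ 2 + 24 * x + 54 * s - 1)) * h27
  · rintro ⟨y, hy⟩
    obtain ⟨w, hw⟩ : ∃ w : ResidueField ℤ_[p], 3 * w = 1 := ⟨3⁻¹, mul_inv_cancel₀ h3⟩
    refine Splits.of_degree_eq_two hdeg (x := w * (y - 1)) ?_
    rw [heval]
    have h81E : (81 : ResidueField ℤ_[p]) *
        ((1 - 24 * s) * (w * (y - 1)) ^ 2 + (1 - 24 * s) * (w * (y - 1)) - (54 * s ^ 2 - 3 * s)) = 0 := by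
      linear_combination hy + ((y - 1) * ((3 * w + 1) * (y - 1) + 3)) * hw +
        (-3 * (24 * (w * (y - 1)) ^ 2 + 24 * (w * (y - 1)) + 54 * s - 1)) * h27
    rcases mul_eq_zero.mp h81E with h | h
    · exact absurd h h81
    · exact h

/-- **`E_t / ℚ_p` has SPLIT multiplicative reduction at `p ∣ 27 t − 1` iff `p ≡ 1 (mod 3)`** (the
equation itself, which is minimal). -/
theorem hasSplitMultiplicativeReduction_hesse_padic_iff {t : ℤ} (hpt : (p : ℤ) ∣ 27 * t - 1) :
    (WeierstrassCurve.mk 1 0 (t : ℚ_[p]) 0 0).HasSplitMultiplicativeReduction ℤ_[p] ↔ p % 3 = 1 := by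
  constructor
  · intro h
    have hs := h.splitMultiplicativeReduction
    rw [integralModel_hesse_padic] at hs
    change Splits (Polynomial.map (algebraMap ℤ_[p] (ResidueField ℤ_[p])) _) at hs
    rwa [nodalTangents_hesse_padic, splits_nodalTangents_hesse_iff hpt] at hs
  · intro h1
    haveI := hasMultiplicativeReduction_hesse_padic hpt
    refine ⟨?_⟩
    rw [integralModel_hesse_padic]
    change Splits (Polynomial.map (algebraMap ℤ_[p] (ResidueField ℤ_[p])) _)
    rwa [nodalTangents_hesse_padic, splits_nodalTangents_hesse_iff hpt]

/-- `Δ(E_t / ℚ_p) ≠ 0` for an integer `t ≥ 1`. -/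
theorem Δ_hesse_padic_ne_zero {t : ℤ} (ht : 1 ≤ t) :
    (WeierstrassCurve.mk 1 0 (t : ℚ_[p]) 0 0).Δ ≠ 0 := by
  rw [hesse_Δ]
  have h1 : (t : ℚ_[p]) ≠ 0 := by exact_mod_cast (show t ≠ 0 by omega)
  have h2 : (1 - 27 * (t : ℚ_[p])) ≠ 0 := by
    have : ((1 - 27 * t : ℤ) : ℚ_[p]) ≠ 0 := by exact_mod_cast (show (1 - 27 * t : ℤ) ≠ 0 by omega)
    simpa using this
  exact mul_ne_zero (pow_ne_zero _ h1) h2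

/-- **`E_t / ℚ` has split multiplicative reduction at a prime `p ∣ 27 t − 1` iff `p ≡ 1 (mod 3)`**,
in the tree's `p`-adic spelling (Mathlib's chosen `ℤ_p`-minimal model; transfer from the equation
`E_t / ℚ_p`, itself minimal, by `hasSplitMultiplicativeReduction_iff_of_isMinimal_of_eq_smul`). -/
theorem hasSplitMultiplicativeReductionAtPrime_hesse_iff {t : ℤ} (ht : 1 ≤ t)
    (hpt : (p : ℤ) ∣ 27 * t - 1) :
    (WeierstrassCurve.mk 1 0 (t : ℚ) 0 0).HasSplitMultiplicativeReductionAtPrime p ↔ p % 3 = 1 := by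
  unfold HasSplitMultiplicativeReductionAtPrime
  rw [baseChange_padic_hesse_rat]
  set X : WeierstrassCurve ℚ_[p] := WeierstrassCurve.mk 1 0 (t : ℚ_[p]) 0 0 with hX
  haveI : X.IsMinimal ℤ_[p] := isMinimal_hesse_padic hpt
  have hmin : X.minimal ℤ_[p] = (X.exists_isMinimal ℤ_[p]).choose • X := rfl
  rw [hasSplitMultiplicativeReduction_iff_of_isMinimal_of_eq_smul ℤ_[p] hmin (Δ_hesse_padic_ne_zero ht)]
  exact hasSplitMultiplicativeReduction_hesse_padic_iff hpt

end Split

end Summit.QuantumAdvantage.QuantumAdvantage.Theorems.LiouvilleNotPPoly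

end
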